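import Summits.MatrixMultiplication.OmegaCensus.SmallFormats.MatMul22nRankGF5XCapSlack
import Summits.MatrixMultiplication.OmegaCensus.SmallFormats.MatMul22nRankGF5XCapS3Cert
import Summits.MatrixMultiplication.OmegaCensus.SmallFormats.MatMul22nRankGF5ThreeNPlusThree
import HarnessLib

/-!
# ω-census family (a): `R_𝔽₅(⟨2,2,n⟩) ≥ 3n + 4` for `n ≥ 27` — kernel replay of the slack-3 branch-and-bound certificate

Cell `pub-omega` (unit `pub-omega-tensor-g8`), topic `Summits/MatrixMultiplication/OmegaCensus` (sub-folder `SmallFormats`).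
Framing (verbatim): lottery ticket; floor = certified bounds/negative ranges. HONEST FRAMING: print (Alekseev 2014/2015, any field)
is `3n + 2`; the tree has `3n + 3` over `𝔽₅` from `n = 17` (`MatMul22nRankGF5ThreeNPlusThree`) and `27·R ≥ 84·n`, which gives
`3n + 4` only from `n ≥ 28`; this file adds the cell `n = 27` over `𝔽₅` (`R_𝔽₅(⟨2,2,27⟩) ≥ 85`) by a kernel-checked replay
(`xcapS3Cert5_ok`) of the certificate that the slack-3 X-cap system `xcapSys5s 3` has no solution of total `≥ 84`, combined with the
two sandwich normalisations of `exists_wlog_transport` and the slack-generic core `card_lt_of_cert_slack`. Nothing here is progress on `ω`.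
-/

namespace Summit.MatrixMultiplication.OmegaCensus.SmallFormats

open Module Matrix Finset Literature.Computability.AlgebraicComplexity

/-- **`R_𝔽₅(⟨2,2,n⟩) ≥ 3n + 4` for every `n ≥ 27`** (cell `n = 27` new; `n ≥ 28` also by `27·R ≥ 84·n`). -/
theorem three_mul_add_four_le_tensorRank_matMulTensor_22n_gf5 (n : ℕ) (hn : 27 ≤ n) :
    3 * n + 4 ≤ tensorRank (matMulTensor (ZMod 5) 2 2 n) := by
  classical
  have h3 := three_mul_add_three_le_tensorRank_matMulTensor_22n_gf5 n (by omega)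
  by_contra hlt
  obtain ⟨w, u, v, hdec⟩ := exists_triad_decomposition_tensorRank (matMulTensor (ZMod 5) 2 2 n)
  have hA : ∀ i x, (bilinCompOfTriads (ZMod 5) w u v hdec).f i x = dotX (u i) x := fun i x => rfl
  obtain ⟨β', u', hA', hW⟩ := exists_wlog_transport (bilinCompOfTriads (ZMod 5) w u v hdec) u hA
  have hr : Fintype.card (Fin (tensorRank (matMulTensor (ZMod 5) 2 2 n))) ≤ 3 * n + 3 := by
    simp only [Fintype.card_fin]; omega
  have h84 := card_lt_of_cert_slack xcapS3Cert5 xcapS3Cert5_ok hr β' u' hA' hW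
  simp only [Fintype.card_fin] at h84
  omega

/-- The kernel window over `𝔽₅` from `n = 27` on: `max(3n + 4, ⌈28n/9⌉) ≤ R_𝔽₅(⟨2,2,n⟩) ≤ ⌈7n/2⌉`. -/
theorem tensorRank_matMulTensor_22n_gf5_window27 (n : ℕ) (hn : 27 ≤ n) :
    max (3 * n + 4) ((28 * n + 8) / 9) ≤ tensorRank (matMulTensor (ZMod 5) 2 2 n) ∧
      tensorRank (matMulTensor (ZMod 5) 2 2 n) ≤ (7 * n + 1) / 2 := by
  have h1 := three_mul_add_four_le_tensorRank_matMulTensor_22n_gf5 n hn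
  have h2 := (tensorRank_matMulTensor_22n_gf5_window n (by omega)).1
  refine ⟨max_le h1 (le_trans (le_max_right _ _) h2), hopcroftKerr1971_tensorRank_matMulTensor_22n_le (K := ZMod 5) n⟩

/-- The census cell this file adds over `𝔽₅` (beyond `3n + 3`): `85 ≤ R_𝔽₅(⟨2,2,27⟩) ≤ 95`. -/
theorem tensorRank_matMulTensor_22n_gf5_numerals_27 : tensorRank (matMulTensor (ZMod 5) 2 2 27) ∈ Set.Icc 85 95 :=
  ⟨three_mul_add_four_le_tensorRank_matMulTensor_22n_gf5 27 (by norm_num),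
    hopcroftKerr1971_tensorRank_matMulTensor_22n_le (K := ZMod 5) 27⟩

/-- Orientations: `3n + 4 ≤ R` over `𝔽₅` for `⟨2,n,2⟩` and `⟨n,2,2⟩` as well (`n ≥ 27`). -/
theorem three_mul_add_four_le_tensorRank_matMulTensor_2n2_n22_gf5 (n : ℕ) (hn : 27 ≤ n) :
    3 * n + 4 ≤ tensorRank (matMulTensor (ZMod 5) 2 n 2) ∧ 3 * n + 4 ≤ tensorRank (matMulTensor (ZMod 5) n 2 2) := by
  constructor
  · rw [(Blaser2013_lemma55 (ZMod 5) 2 n 2).1]; exact three_mul_add_four_le_tensorRank_matMulTensor_22n_gf5 n hn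
  · rw [(Blaser2013_lemma55 (ZMod 5) n 2 2).2.1]; exact three_mul_add_four_le_tensorRank_matMulTensor_22n_gf5 n hn

end Summit.MatrixMultiplication.OmegaCensus.SmallFormats
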